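import Literature.Analysis.FluidPDE.TypeIAncientMild
import Literature.Analysis.UnboundedOperators.HeatExtensionDecay
import HarnessLib

/-!
# A Type-I ancient mild field is minus its own Duhamel integral from `-∞` — crux
  stmt-NavierStokesRegularity-1404 (`QuantisedSymmetry.PolyhedralDssProfileExists`), line
  polyhedral_cell, stub stub_ancientDuhamel (N21)

Registered stub `stub_ancientDuhamel` (`--supports stmt-NavierStokesRegularity-1404`). For a
Type-I ancient mild Navier–Stokes field `V` in the Oseen (KNSS) gauge with constant `C`
(`IsTypeIAncientMild C V`):

1. for all `s < t < 0` and `x`, `‖V t x + B¹_s(V,V)(t)(x)‖ ≤ C/√(-s)`;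
2. for all `t < 0` and `x`, `B¹_s(V,V)(t)(x) → -V t x` as `s → -∞`,

i.e. the free (caloric) part `e^{(t-s)Δ}V(s)` of the Oseen representation dies out as `s → -∞`
and `V` solves the quadratic fixed-point equation `V = -B_{-∞}(V,V)` (KNSS 2009, §4 p. 8 and §6
p. 11; Seregin 2014, §6.3).

Proof sketch. (1) By the Oseen integral equation `V t x = e^{(t-s)Δ}V(s)(x) - B¹_s(V,V)(t)(x)`
(`IsTypeIAncientMild.mild_eq`), `V t x + B¹_s(V,V)(t)(x) = heatFlow (V s) (t - s) x`, and the heat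
flow obeys the maximum principle `‖heatFlow g σ x‖ ≤ C'` whenever `‖g‖ ≤ C'` pointwise
(`norm_heatFlow_le`); take `g = V s`, `C' = C/√(-s)` (the Type-I bound at time `s < 0`).
(2) For `s < t`, `B¹_s(V,V)(t)(x) - (-V t x) = heatFlow (V s) (t - s) x` has norm `≤ C/√(-s)`,
and `C/√(-s) → 0` as `s → -∞` (`√(-s) → ∞`); squeeze.
-/

noncomputable section

-- the summit namespace `…NavierStokesRegularity.NavierStokesRegularity…` is the tree convention (D-0017)
set_option linter.dupNamespace false

namespace Summit.NavierStokesRegularity.NavierStokesRegularity.Theorems.PolyhedralDssProfileExists.PolyhedralCell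

open MeasureTheory Set Function Filter Topology
open Literature.Analysis Literature.Analysis.FluidPDE

/-! ### The free part of the Oseen representation -/

/-- **The free part.** For a Type-I ancient mild field `V` in the Oseen gauge and `s < t < 0`,
`V t x + B¹_s(V,V)(t)(x) = e^{(t-s)Δ}V(s)(x)` (rearranging the Oseen integral equation
`V(t) = e^{(t-s)Δ}V(s) - B¹_s(V,V)(t)`, KNSS 2009, §4 p. 8).
[cite: KochNadirashviliSereginSverak2009, §4 p. 8 (arXiv:0709.3599)] -/
theorem ancientDuhamel_add_eq_heatFlow {C : ℝ}
    {V : ℝ → EuclideanSpace ℝ (Fin 3) → EuclideanSpace ℝ (Fin 3)} (hV : IsTypeIAncientMild C V)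
    {s t : ℝ} (hst : s < t) (ht : t < 0) (x : EuclideanSpace ℝ (Fin 3)) :
    V t x + oseenDuhamel 1 s V V t x = heatFlow (V s) (t - s) x := by
  rw [hV.mild_eq hst ht x, sub_add_cancel]

/-- **Bound on the free part.** For a Type-I ancient mild field `V` with constant `C` and
`s < t < 0`, `‖V t x + B¹_s(V,V)(t)(x)‖ ≤ C/√(-s)`: the free part is the heat flow of the slice
`V s`, which is bounded by `C/√(-s)` (Type-I bound), and the heat flow does not increase the sup
norm (maximum principle, Evans *PDE* §2.3.1). [folklore] -/
theorem norm_ancientDuhamel_add_le {C : ℝ}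
    {V : ℝ → EuclideanSpace ℝ (Fin 3) → EuclideanSpace ℝ (Fin 3)} (hV : IsTypeIAncientMild C V)
    {s t : ℝ} (hst : s < t) (ht : t < 0) (x : EuclideanSpace ℝ (Fin 3)) :
    ‖V t x + oseenDuhamel 1 s V V t x‖ ≤ C / Real.sqrt (-s) := by
  rw [ancientDuhamel_add_eq_heatFlow hV hst ht x]
  exact norm_heatFlow_le (fun z => hV.norm_le (hst.trans ht) z) _ x

/-- **The Type-I envelope dies out in the remote past**: `C/√(-s) → 0` as `s → -∞`. [folklore] -/
theorem tendsto_typeI_envelope_atBot (C : ℝ) :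
    Tendsto (fun s : ℝ => C / Real.sqrt (-s)) atBot (𝓝 0) :=
  (Real.tendsto_sqrt_atTop.comp tendsto_neg_atBot_atTop).const_div_atTop C

/-! ### The registered stub -/

/-- **REGISTERED STUB `stub_ancientDuhamel` (N21): a Type-I ancient mild field in the Oseen gauge
is minus its own Duhamel integral from `-∞` (no free part).** For `IsTypeIAncientMild C V`:
(1) `‖V t x + B¹_s(V,V)(t)(x)‖ ≤ C/√(-s)` for all `s < t < 0`, `x` — the left side is the free
caloric part `e^{(t-s)Δ}V(s)(x)` of the Oseen representation (`IsTypeIAncientMild.mild_eq`), bounded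
by the sup of `‖V(s)‖ ≤ C/√(-s)` via the maximum principle for the heat flow (`norm_heatFlow_le`);
(2) `B¹_s(V,V)(t)(x) → -V t x` as `s → -∞` for all `t < 0`, `x` — by (1) on the eventual set
`s < t` and `C/√(-s) → 0`. This is the quadratic fixed-point form `V = -B_{-∞}(V,V)` of ancient
mild solutions (KNSS 2009, §4 p. 8, `u = U + B(u,u)`, with §6 p. 11; Seregin 2014, §6.3).
[cite: KochNadirashviliSereginSverak2009, §4 p. 8 and §6 p. 11 (arXiv:0709.3599)] -/
theorem stub_ancientDuhamel :
    ∀ (V : ℝ → EuclideanSpace ℝ (Fin 3) → EuclideanSpace ℝ (Fin 3)) (C : ℝ),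
      IsTypeIAncientMild C V →
      (∀ s t : ℝ, s < t → t < 0 → ∀ x, ‖V t x + oseenDuhamel 1 s V V t x‖ ≤ C / Real.sqrt (-s)) ∧
      (∀ t < 0, ∀ x, Tendsto (fun s => oseenDuhamel 1 s V V t x) atBot (𝓝 (-(V t x)))) := by
  intro V C hV
  refine ⟨fun s t hst ht x => norm_ancientDuhamel_add_le hV hst ht x, fun t ht x => ?_⟩
  rw [tendsto_iff_norm_sub_tendsto_zero]
  refine squeeze_zero' (Eventually.of_forall fun _ => norm_nonneg _) ?_
    (tendsto_typeI_envelope_atBot C)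
  filter_upwards [eventually_lt_atBot t] with s hs
  rw [sub_neg_eq_add, add_comm]
  exact norm_ancientDuhamel_add_le hV hs ht x

end Summit.NavierStokesRegularity.NavierStokesRegularity.Theorems.PolyhedralDssProfileExists.PolyhedralCell

end
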